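import Mathlib
import HarnessLib
import Literature.Analysis.FluidPDE.VectorCalculus
import Literature.Analysis.FluidPDE.VorticityCalculus
import Literature.Analysis.FluidPDE.TaoEnstrophyLocalisation
import Summits.NavierStokesRegularity.NavierStokesRegularity.Theses.LoopPeriodRatchet
import Summits.NavierStokesRegularity.NavierStokesRegularity.Theorems.PoloidalWindowDoorPoloidalWindowRigidityClebsch
import Summits.NavierStokesRegularity.NavierStokesRegularity.Theorems.PoloidalWindowDoorPoloidalWindowRigidityClassSpaceTimeRates

/-!
# Route `LoopPeriodRatchet`, support `PeriodScalingBound` (stmt-NavierStokesRegularity-22494) — proved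

Support item of the D-0145 line `LoopPeriodRatchet` (ideator ns-idea-1; bears on the DOOR rung
N0-LocalTubeDoorPoloidal = `PoloidalWindowDoor.Target`; no summit and no Clay option is proved here).
Statement: for every Type-I constant `C` there is `M` such that for every Type-I Oseen-mild ancient profile `v`
with constant `C` (rate `‖v(t,x)‖ ≤ C/√(−t)`, continuity on the open slab, unit-viscosity Oseen–Duhamel identity
between negative times, divergence-free slices), every `s < 0` and every NON-STATIONARY periodic orbit `γ` of the
frozen-slice ODE `y′ = curl v(s)(y)` with a period `ℓ > 0`: `ℓ⁻¹ ≤ M (−s)^{−3/2}`.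

Proof = the two «known ingredients» of the item, both taken from the tree:
* the UNIFORM second-derivative class rate `‖D²v(s)(y)‖ ≤ K(C)/√(−s)³`
  (`…PoloidalWindowDoorPoloidalWindowRigidityClassSpaceTimeRates.exists_spaceTime_rate_of_class C 2 0`, KNSS 2009
  Prop. 4.1 with uniform constants), smoothness of the slices (`…Clebsch.contDiff_slice`) and
  `‖D(curl v)‖ ≤ ‖curlCLM‖ ‖D²v‖` (`norm_fderiv_curl_le`), whence `curl v(s)` is Lipschitz with constant
  `L = ‖curlCLM‖ K /√(−s)³` (mean value inequality, `lipschitzWith_of_nnnorm_fderiv_le`);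
* an elementary WEAK YORKE BOUND `ℓ⁻¹ ≤ L` for non-constant periodic orbits of an `L`-Lipschitz field
  (`inv_period_le_of_lipschitzWith`; Yorke 1969 gives the sharp `ℓ ≥ 2π/L`, the constant is immaterial here):
  at a maximum `θ₀` of `‖γ′‖ = m > 0`, `ℓ γ′(θ₀) = ∫_{θ₀}^{θ₀+ℓ} (γ′(θ₀) − γ′(θ)) dθ` because `∮ γ′ = 0`, and
  `‖γ′(θ₀) − γ′(θ)‖ = ‖F(γ θ₀) − F(γ θ)‖ ≤ L·m·ℓ`, so `ℓ m ≤ L m ℓ²`.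
Finally `1/√(−s)³ = (−s)^{−3/2}`. Sources: J. A. Yorke, Proc. AMS 22 (1969) 509–512 (period bound);
Koch–Nadirashvili–Seregin–Šverák, Acta Math. 203 (2009), Prop. 4.1 (smoothing).
-/

noncomputable section

-- the summit and its single sub-problem share the name (CONVENTIONS §1), as in every Theorems file
set_option linter.dupNamespace false

namespace Summit.NavierStokesRegularity.NavierStokesRegularity.Theorems.LoopPeriodRatchetPeriodScalingBound

open MeasureTheory Set Function Filter Topology intervalIntegral
open scoped NNReal Interval ContDiff
open Literature.Analysis Literature.Analysis.FluidPDE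
open Summit.NavierStokesRegularity.NavierStokesRegularity.Theses.LoopPeriodRatchet
open Summit.NavierStokesRegularity.NavierStokesRegularity.Theorems.PoloidalWindowDoorPoloidalWindowRigidityClebsch
open Summit.NavierStokesRegularity.NavierStokesRegularity.Theorems.PoloidalWindowDoorPoloidalWindowRigidityClassSpaceTimeRates

/-! ### A weak Yorke bound: periods of non-constant periodic orbits of Lipschitz fields -/

/-- **Weak Yorke bound.** If `F` is `L`-Lipschitz on a real normed space and `γ` is a global solution of
`γ′ = F(γ)` with `γ(θ + ℓ) = γ(θ)` for all `θ`, `ℓ > 0`, and `F(γ 0) ≠ 0`, then `ℓ⁻¹ ≤ L` (Yorke 1969 proves the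
sharp `ℓ ≥ 2π/L`; any such bound serves the route). Proof: with `m = max ‖γ′‖ > 0` attained at `θ₀`,
`ℓ • γ′(θ₀) = ∫_{θ₀}^{θ₀+ℓ} (γ′(θ₀) − γ′(θ)) dθ` (the integral of `γ′` over a period vanishes) and the
integrand is bounded by `L m ℓ` (Lipschitz bound and the mean value inequality), so `ℓ m ≤ L m ℓ²`. -/
theorem inv_period_le_of_lipschitzWith {E : Type*} [NormedAddCommGroup E] [NormedSpace ℝ E]
    [CompleteSpace E] {F : E → E} {L : ℝ≥0} (hF : LipschitzWith L F) {γ : ℝ → E} {ℓ : ℝ} (hℓ : 0 < ℓ)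
    (hγ : ∀ θ, HasDerivAt γ (F (γ θ)) θ) (hper : ∀ θ, γ (θ + ℓ) = γ θ) (hne : F (γ 0) ≠ 0) :
    ℓ⁻¹ ≤ (L : ℝ) := by
  -- the velocity `V = F ∘ γ` is continuous and `ℓ`-periodic
  set V : ℝ → E := fun θ => F (γ θ) with hV
  have hγc : Continuous γ := continuous_iff_continuousAt.2 fun θ => (hγ θ).continuousAt
  have hVc : Continuous V := hF.continuous.comp hγc
  have hVper : Function.Periodic V ℓ := fun θ => by simp only [hV, hper θ]
  -- maximum of `‖V‖` over one period, attained at `θ₀`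
  obtain ⟨θ₀, -, hmax⟩ := (isCompact_Icc (a := (0 : ℝ)) (b := ℓ)).exists_isMaxOn
    ⟨0, left_mem_Icc.2 hℓ.le⟩ (hVc.norm.continuousOn)
  set m : ℝ := ‖V θ₀‖ with hm
  have hbound : ∀ θ, ‖V θ‖ ≤ m := by
    intro θ
    obtain ⟨y, hy, hVy⟩ := hVper.exists_mem_Ico₀ hℓ θ
    rw [hVy]
    exact hmax (Ico_subset_Icc_self hy)
  have hm0 : 0 < m := lt_of_lt_of_le (norm_pos_iff.2 hne) (hbound 0)
  -- mean value inequality: `‖γ θ − γ θ₀‖ ≤ m |θ − θ₀|`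
  have hmv : ∀ θ, ‖γ θ - γ θ₀‖ ≤ m * ‖θ - θ₀‖ := fun θ =>
    convex_univ.norm_image_sub_le_of_norm_hasDerivWithin_le (f := γ) (f' := V)
      (fun x _ => (hγ x).hasDerivWithinAt) (fun x _ => hbound x) (mem_univ θ₀) (mem_univ θ)
  -- the integrand bound on the period `(θ₀, θ₀ + ℓ]`
  have hint_bd : ∀ θ ∈ Ι θ₀ (θ₀ + ℓ), ‖V θ₀ - V θ‖ ≤ L * (m * ℓ) := by
    intro θ hθ
    rw [uIoc_of_le (by linarith)] at hθ
    have h1 : ‖V θ₀ - V θ‖ ≤ L * ‖γ θ₀ - γ θ‖ := hF.norm_sub_le _ _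
    have h2 : ‖γ θ₀ - γ θ‖ ≤ m * ℓ := by
      rw [norm_sub_rev]
      refine (hmv θ).trans (mul_le_mul_of_nonneg_left ?_ hm0.le)
      rw [Real.norm_eq_abs, abs_of_nonneg (by linarith [hθ.1])]
      linarith [hθ.2]
    exact h1.trans (mul_le_mul_of_nonneg_left h2 L.coe_nonneg)
  -- `∫_{θ₀}^{θ₀+ℓ} V = γ(θ₀ + ℓ) − γ(θ₀) = 0`
  have hFTC : ∫ θ in θ₀..θ₀ + ℓ, V θ = 0 := by
    rw [integral_eq_sub_of_hasDerivAt (fun θ _ => hγ θ) (hVc.intervalIntegrable _ _), hper, sub_self]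
  -- `ℓ • V θ₀ = ∫ (V θ₀ − V θ)`
  have hkey : ℓ • V θ₀ = ∫ θ in θ₀..θ₀ + ℓ, (V θ₀ - V θ) := by
    rw [intervalIntegral.integral_sub intervalIntegrable_const (hVc.intervalIntegrable _ _), hFTC,
      intervalIntegral.integral_const, sub_zero, add_sub_cancel_left]
  have hnorm : ℓ * m ≤ L * (m * ℓ) * ℓ := by
    have h := norm_integral_le_of_norm_le_const hint_bd
    rw [← hkey, norm_smul, Real.norm_eq_abs, abs_of_pos hℓ, add_sub_cancel_left, abs_of_pos hℓ] at h
    exact h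
  -- divide by `ℓ m > 0`
  have h1 : 1 ≤ (L : ℝ) * ℓ := by
    have h : ℓ * m * 1 ≤ ℓ * m * (L * ℓ) := by nlinarith
    exact le_of_mul_le_mul_left h (mul_pos hℓ hm0)
  rw [inv_eq_one_div, div_le_iff₀ hℓ]
  exact h1

/-! ### The class: Lipschitz constant of the frozen vorticity field and the period bound -/

/-- `1/√(−s)³ = (−s)^{−3/2}` for `s < 0`. -/
theorem inv_sqrt_pow_three_eq_rpow {s : ℝ} (hs : s < 0) :
    (Real.sqrt (-s) ^ 3)⁻¹ = (-s) ^ (-(3 : ℝ) / 2) := by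
  have hns : 0 ≤ -s := (neg_pos.2 hs).le
  rw [show (-(3 : ℝ) / 2) = -((1 / 2) * 3) by norm_num, Real.rpow_neg hns, Real.rpow_mul hns,
    ← Real.sqrt_eq_rpow, show ((3 : ℝ)) = ((3 : ℕ) : ℝ) by norm_num, Real.rpow_natCast]

/-- **`PeriodScalingBound` (stmt-NavierStokesRegularity-22494).** For every `C` there is `M = ‖curlCLM‖·K₂(C)` (`K₂`
the uniform second-derivative class rate) such that every non-stationary periodic orbit of `y′ = curl v(s)(y)`,
`s < 0`, of a Type-I Oseen-mild ancient profile `v` with constant `C` has inverse period `ℓ⁻¹ ≤ M(−s)^{−3/2}`. -/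
theorem periodScalingBound_proof : PeriodScalingBound := by
  unfold PeriodScalingBound
  intro C
  obtain ⟨K, hK0, hK⟩ := exists_spaceTime_rate_of_class C 2 0
  refine ⟨‖curlCLM‖ * K, ?_⟩
  intro v hrate hcont hmild _hdiv s hs γ ℓ hℓ hγ hper hne
  have hns : 0 < -s := neg_pos.2 hs
  have hsq : 0 < Real.sqrt (-s) := Real.sqrt_pos.2 hns
  -- smoothness of the slice and the uniform `D²` rate at time `s`
  have hV : ContDiff ℝ ∞ (v s) := contDiff_slice hrate hcont hmild hs
  have hV2 : ContDiff ℝ 2 (v s) := hV.of_le (by norm_cast)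
  have hD2 : ∀ y, ‖iteratedFDeriv ℝ 2 (v s) y‖ ≤ K / Real.sqrt (-s) ^ 3 := by
    intro y
    have h := hK v hrate hcont hmild s hs y
    have hid : (fun y' => iteratedDeriv 0 (fun τ => v τ y') s) = v s := by
      funext y'; rw [iteratedDeriv_zero]
    rw [hid] at h
    simpa using h
  -- `curl v(s)` is Lipschitz with constant `Lr = ‖curlCLM‖ K / √(−s)³`
  set Lr : ℝ := ‖curlCLM‖ * (K / Real.sqrt (-s) ^ 3) with hLr
  have hLr0 : 0 ≤ Lr := mul_nonneg (norm_nonneg curlCLM) (div_nonneg hK0 (pow_nonneg hsq.le _))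
  have hcurl1 : ContDiff ℝ 1 (curl (v s)) := contDiff_curl (n := 1) (hV.of_le (by norm_cast))
  have hlip : LipschitzWith (Real.toNNReal Lr) (curl (v s)) := by
    refine lipschitzWith_of_nnnorm_fderiv_le (hcurl1.differentiable one_ne_zero) fun y => ?_
    rw [← NNReal.coe_le_coe, coe_nnnorm, Real.coe_toNNReal _ hLr0]
    exact (norm_fderiv_curl_le hV2 y).trans (mul_le_mul_of_nonneg_left (hD2 y) (norm_nonneg curlCLM))
  -- the weak Yorke bound
  have h := inv_period_le_of_lipschitzWith hlip hℓ hγ hper hne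
  rw [Real.coe_toNNReal _ hLr0, hLr] at h
  rw [← inv_sqrt_pow_three_eq_rpow hs]
  calc ℓ⁻¹ ≤ ‖curlCLM‖ * (K / Real.sqrt (-s) ^ 3) := h
    _ = ‖curlCLM‖ * K * (Real.sqrt (-s) ^ 3)⁻¹ := by rw [div_eq_mul_inv, mul_assoc]

end Summit.NavierStokesRegularity.NavierStokesRegularity.Theorems.LoopPeriodRatchetPeriodScalingBound

end
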